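import Mathlib

/-!
# Route BarrierLever — item `PartitionMinorsHitByVP` (stmt-ValiantsHypothesis-19717), line `hidden_states`:
# TRANSLATION INVARIANCE OF THE FULL JOIN ON LOWER PAIRS — the base rows of the tables are irrelevant

Helper file (`--supports stmt-ValiantsHypothesis-19717`; cell valiant-natproofs, rung V4, 𝒟-side door (c), line
`Cruxes/PartitionMinorsHitByVP/Lines/hidden_states.lean` v8; prover seat val-np-p3 gen 16). Definition-free, `import Mathlib` only. Closes NO item.

THE POINT (memo val-np-p3 g16 «full join» §13–§14). For the one-cube hidden sum `M[U,W] = Σ_J λ^J X_J^U Y_J^W`,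
`X_J^U = ∏_{a∈U} (tx₀(a) + Σ_{q∈J} tx_q(a))`, shifting the BASE ROW `tx₀ ↦ tx₀ + γ` replaces row `U` by `row U + Σ_{∅≠V⊆U} γ^V · row (U∖V)`:
when the row family is a LOWER set these are elementary row operations, so **the determinant does not change** (`fullJoin_det_translate`; one
coordinate at a time, each a sequence of `det_updateRow_add_smul_self`). Same on the column side (`fullJoin_det_translate'`, by transposition). Hence
for lower pairs conjecture FJ may take both base rows ZERO (`fullJoinCube_zeroBase`): the x-table is then a generic LINEAR image of the cube
`{0,1}^K`, `X_J^U = x^U(G·1_J)` — the normal form used in memo §13(a)/§14(a) (in the square-free ring: multiplying the witness by the unit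
`m_γ(x) = ∏_c (1 + γ_c x_c)` does not change down-set minors).

WHAT THIS IS NOT: no pair is certified here; item 19717 stays OPEN; nothing on crux 14610 or VP ≠ VNP.
-/

set_option linter.dupNamespace false

namespace Summit.ValiantsHypothesis.ValiantsHypothesis.Theorems.BarrierLever.HiddenStates

open Finset Matrix

noncomputable section

namespace FullJoin

variable {h K r : ℕ}

/-- Shifting the base entry of ONE coordinate `c` by `t` (`tx'` = the shifted table): the block-additive factor of a set `U ∋ c` picks
up `t ·` (the factor of `U ∖ c`); a set `U ∌ c` is unchanged. -/
theorem xFactor_shift_one (tx tx' : Option (Fin K) → Fin h → ℂ) (c : Fin h) (t : ℂ) (hc : tx' none c = tx none c + t)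
    (hne : ∀ b, b ≠ c → tx' none b = tx none b) (hs : ∀ q b, tx' (some q) b = tx (some q) b)
    (U : Finset (Fin h)) (J : Finset (Fin K)) :
    (∏ a ∈ U, (tx' none a + ∑ q ∈ J, tx' (some q) a)) =
      (∏ a ∈ U, (tx none a + ∑ q ∈ J, tx (some q) a)) +
        (if c ∈ U then t * ∏ a ∈ U.erase c, (tx none a + ∑ q ∈ J, tx (some q) a) else 0) := by
  classical
  have hsum : ∀ a, ∑ q ∈ J, tx' (some q) a = ∑ q ∈ J, tx (some q) a := fun a => Finset.sum_congr rfl fun q _ => hs q a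
  simp only [hsum]
  by_cases hcU : c ∈ U
  · rw [if_pos hcU, ← Finset.mul_prod_erase U _ hcU, ← Finset.mul_prod_erase U _ hcU, hc]
    have hrest : ∏ a ∈ U.erase c, (tx' none a + ∑ q ∈ J, tx (some q) a) = ∏ a ∈ U.erase c, (tx none a + ∑ q ∈ J, tx (some q) a) :=
      Finset.prod_congr rfl fun a ha => by rw [hne a (Finset.ne_of_mem_erase ha)]
    rw [hrest]; ring
  · rw [if_neg hcU, add_zero]
    exact Finset.prod_congr rfl fun a ha => by rw [hne a (fun h' => hcU (h' ▸ ha))]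

/-- **Translation invariance, one coordinate (rows).** For an injective LOWER row family `u`, shifting the base entry `tx none c` by `t`
(table `tx'`) does not change the determinant of the one-cube full hidden sum. -/
theorem fullJoin_det_translate_one (u w : Fin r → Finset (Fin h)) (hul : IsLowerSet (Set.range u))
    (tx tx' ty : Option (Fin K) → Fin h → ℂ) (lam : Fin K → ℂ) (c : Fin h) (t : ℂ) (hc : tx' none c = tx none c + t)
    (hne : ∀ b, b ≠ c → tx' none b = tx none b) (hs : ∀ q b, tx' (some q) b = tx (some q) b) :
    (Matrix.of fun i j : Fin r => ∑ J : Finset (Fin K), (∏ q ∈ J, lam q) *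
        ((∏ a ∈ u i, (tx' none a + ∑ q ∈ J, tx' (some q) a)) * ∏ e ∈ w j, (ty none e + ∑ q ∈ J, ty (some q) e))).det =
      (Matrix.of fun i j : Fin r => ∑ J : Finset (Fin K), (∏ q ∈ J, lam q) *
        ((∏ a ∈ u i, (tx none a + ∑ q ∈ J, tx (some q) a)) * ∏ e ∈ w j, (ty none e + ∑ q ∈ J, ty (some q) e))).det := by
  classical
  set M : Matrix (Fin r) (Fin r) ℂ := Matrix.of fun i j : Fin r => ∑ J : Finset (Fin K), (∏ q ∈ J, lam q) *
        ((∏ a ∈ u i, (tx none a + ∑ q ∈ J, tx (some q) a)) * ∏ e ∈ w j, (ty none e + ∑ q ∈ J, ty (some q) e)) with hM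
  -- the deletion partner of a row containing `c`
  have hpartner : ∀ i : Fin r, c ∈ u i → ∃ i' : Fin r, u i' = (u i).erase c := fun i _ => by
    have hmem : (u i).erase c ∈ Set.range u := hul (Finset.erase_subset c (u i)) (Set.mem_range_self i)
    obtain ⟨i', hi'⟩ := hmem
    exact ⟨i', hi'⟩
  choose! jx hjx using hpartner
  set S : Finset (Fin r) := Finset.univ.filter fun i => c ∈ u i with hS
  have hjx_notMem : ∀ i ∈ S, jx i ∉ S := by
    intro i hi
    rw [hS, Finset.mem_filter] at hi ⊢
    rw [hjx i hi.2]
    exact fun h' => Finset.notMem_erase c (u i) h'.2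
  have hjx_ne : ∀ i ∈ S, i ≠ jx i := fun i hi h' => hjx_notMem i hi (h' ▸ hi)
  -- partially updated matrices
  have hstep : ∀ T : Finset (Fin r), T ⊆ S →
      (Matrix.of fun i j => if i ∈ T then M i j + t * M (jx i) j else M i j).det = M.det := by
    intro T
    induction T using Finset.induction_on with
    | empty =>
      intro _
      have h0 : (Matrix.of fun i j => if i ∈ (∅ : Finset (Fin r)) then M i j + t * M (jx i) j else M i j) = M := by
        ext i j; simp
      rw [h0]
    | insert i₀ T hi₀ ih =>
      intro hTS
      have hi₀S : i₀ ∈ S := hTS (Finset.mem_insert_self i₀ T)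
      have hT : T ⊆ S := fun i hi => hTS (Finset.mem_insert_of_mem hi)
      have hjT : jx i₀ ∉ T := fun h' => hjx_notMem i₀ hi₀S (hT h')
      set MT : Matrix (Fin r) (Fin r) ℂ := Matrix.of fun i j => if i ∈ T then M i j + t * M (jx i) j else M i j with hMT
      have hupd : (Matrix.of fun i j => if i ∈ insert i₀ T then M i j + t * M (jx i) j else M i j) =
          MT.updateRow i₀ (MT i₀ + t • MT (jx i₀)) := by
        ext i j
        by_cases hi : i = i₀
        · subst hi
          rw [Matrix.updateRow_self]
          simp only [Matrix.of_apply, Finset.mem_insert, true_or, if_true, Pi.add_apply, Pi.smul_apply, smul_eq_mul, hMT,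
            if_neg hi₀, if_neg hjT]
        · rw [Matrix.updateRow_ne hi]
          simp only [Matrix.of_apply, Finset.mem_insert, hi, false_or, hMT]
      rw [hupd, Matrix.det_updateRow_add_smul_self MT (hjx_ne i₀ hi₀S) t]
      exact ih hT
  -- the shifted matrix is the fully updated one
  have hfull : (Matrix.of fun i j : Fin r => ∑ J : Finset (Fin K), (∏ q ∈ J, lam q) *
        ((∏ a ∈ u i, (tx' none a + ∑ q ∈ J, tx' (some q) a)) * ∏ e ∈ w j, (ty none e + ∑ q ∈ J, ty (some q) e))) =
      Matrix.of fun i j => if i ∈ S then M i j + t * M (jx i) j else M i j := by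
    ext i j
    simp only [Matrix.of_apply]
    simp_rw [xFactor_shift_one tx tx' c t hc hne hs]
    by_cases hci : c ∈ u i
    · have hiS : i ∈ S := by rw [hS, Finset.mem_filter]; exact ⟨Finset.mem_univ i, hci⟩
      simp only [if_pos hci, if_pos hiS, hM, Matrix.of_apply, hjx i hci]
      rw [Finset.mul_sum, ← Finset.sum_add_distrib]
      refine Finset.sum_congr rfl fun J _ => ?_
      ring
    · have hiS : i ∉ S := by rw [hS, Finset.mem_filter]; exact fun h' => hci h'.2
      simp only [if_neg hci, if_neg hiS, hM, Matrix.of_apply, add_zero]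
  rw [hfull]
  exact hstep S (subset_refl S)

/-- **Translation invariance (rows).** For an injective lower row family, replacing the base row `tx none` by `tx none + γ` (any
`γ : Fin h → ℂ`, state rows unchanged) does not change the determinant. -/
theorem fullJoin_det_translate (u w : Fin r → Finset (Fin h)) (hul : IsLowerSet (Set.range u))
    (tx tx' ty : Option (Fin K) → Fin h → ℂ) (lam : Fin K → ℂ) (γ : Fin h → ℂ)
    (h0 : ∀ b, tx' none b = tx none b + γ b) (hs : ∀ q b, tx' (some q) b = tx (some q) b) :
    (Matrix.of fun i j : Fin r => ∑ J : Finset (Fin K), (∏ q ∈ J, lam q) *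
        ((∏ a ∈ u i, (tx' none a + ∑ q ∈ J, tx' (some q) a)) * ∏ e ∈ w j, (ty none e + ∑ q ∈ J, ty (some q) e))).det =
      (Matrix.of fun i j : Fin r => ∑ J : Finset (Fin K), (∏ q ∈ J, lam q) *
        ((∏ a ∈ u i, (tx none a + ∑ q ∈ J, tx (some q) a)) * ∏ e ∈ w j, (ty none e + ∑ q ∈ J, ty (some q) e))).det := by
  classical
  -- tables shifted on a set `C` of coordinates
  have key : ∀ C : Finset (Fin h),
      (Matrix.of fun i j : Fin r => ∑ J : Finset (Fin K), (∏ q ∈ J, lam q) *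
        ((∏ a ∈ u i, ((fun o b => if o = none ∧ b ∈ C then tx o b + γ b else tx o b) none a +
            ∑ q ∈ J, (fun o b => if o = none ∧ b ∈ C then tx o b + γ b else tx o b) (some q) a)) *
          ∏ e ∈ w j, (ty none e + ∑ q ∈ J, ty (some q) e))).det =
      (Matrix.of fun i j : Fin r => ∑ J : Finset (Fin K), (∏ q ∈ J, lam q) *
        ((∏ a ∈ u i, (tx none a + ∑ q ∈ J, tx (some q) a)) * ∏ e ∈ w j, (ty none e + ∑ q ∈ J, ty (some q) e))).det := by
    intro C
    induction C using Finset.induction_on with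
    | empty =>
      have h0' : (fun (o : Option (Fin K)) (b : Fin h) => if o = none ∧ b ∈ (∅ : Finset (Fin h)) then tx o b + γ b else tx o b) = tx := by
        funext o b; simp
      rw [h0']
    | insert c C hc ih =>
      have h1 := fullJoin_det_translate_one u w hul (fun o b => if o = none ∧ b ∈ C then tx o b + γ b else tx o b)
        (fun o b => if o = none ∧ b ∈ insert c C then tx o b + γ b else tx o b) ty lam c (γ c)
        (by simp [hc]) (fun b hb => by simp [Finset.mem_insert, hb]) (fun q b => by simp)
      exact h1.trans ih
  have hfin : tx' = fun o b => if o = none ∧ b ∈ (Finset.univ : Finset (Fin h)) then tx o b + γ b else tx o b := by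
    funext o b
    rcases o with _ | q
    · simp [h0]
    · simp [hs]
  rw [hfin]
  exact key Finset.univ

/-- The one-cube full hidden sum of `(u, w)` with tables `(tx, ty)` is the transpose of that of `(w, u)` with tables `(ty, tx)`. -/
theorem fullJoin_transpose (u w : Fin r → Finset (Fin h)) (tx ty : Option (Fin K) → Fin h → ℂ) (lam : Fin K → ℂ) :
    (Matrix.of fun i j : Fin r => ∑ J : Finset (Fin K), (∏ q ∈ J, lam q) *
        ((∏ a ∈ u i, (tx none a + ∑ q ∈ J, tx (some q) a)) * ∏ e ∈ w j, (ty none e + ∑ q ∈ J, ty (some q) e))) =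
      (Matrix.of fun j i : Fin r => ∑ J : Finset (Fin K), (∏ q ∈ J, lam q) *
        ((∏ e ∈ w j, (ty none e + ∑ q ∈ J, ty (some q) e)) * ∏ a ∈ u i, (tx none a + ∑ q ∈ J, tx (some q) a))).transpose := by
  ext i j
  simp only [Matrix.of_apply, Matrix.transpose_apply]
  exact Finset.sum_congr rfl fun J _ => by ring

/-- **Translation invariance (columns).** The same on the `y` side, for an injective lower column family. -/
theorem fullJoin_det_translate' (u w : Fin r → Finset (Fin h)) (hwl : IsLowerSet (Set.range w))
    (tx ty ty' : Option (Fin K) → Fin h → ℂ) (lam : Fin K → ℂ) (γ : Fin h → ℂ)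
    (h0 : ∀ b, ty' none b = ty none b + γ b) (hs : ∀ q b, ty' (some q) b = ty (some q) b) :
    (Matrix.of fun i j : Fin r => ∑ J : Finset (Fin K), (∏ q ∈ J, lam q) *
        ((∏ a ∈ u i, (tx none a + ∑ q ∈ J, tx (some q) a)) * ∏ e ∈ w j, (ty' none e + ∑ q ∈ J, ty' (some q) e))).det =
      (Matrix.of fun i j : Fin r => ∑ J : Finset (Fin K), (∏ q ∈ J, lam q) *
        ((∏ a ∈ u i, (tx none a + ∑ q ∈ J, tx (some q) a)) * ∏ e ∈ w j, (ty none e + ∑ q ∈ J, ty (some q) e))).det := by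
  rw [fullJoin_transpose u w tx ty' lam, Matrix.det_transpose, fullJoin_det_translate w u hwl ty ty' tx lam γ h0 hs,
    fullJoin_transpose u w tx ty lam, Matrix.det_transpose]

/-- **Zero base rows suffice (lower pairs).** If FJ holds for a lower pair with some tables, it holds with tables whose base rows vanish:
`X_J^U = ∏_{a∈U} Σ_{q∈J} tx_q(a)` — the `x`-points are a LINEAR image of the cube `{0,1}^K`. -/
theorem fullJoinCube_zeroBase (u w : Fin r → Finset (Fin h)) (hul : IsLowerSet (Set.range u)) (hwl : IsLowerSet (Set.range w))
    (H : ∃ (tx ty : Option (Fin K) → Fin h → ℂ) (lam : Fin K → ℂ),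
      (Matrix.of fun i j : Fin r => ∑ J : Finset (Fin K), (∏ q ∈ J, lam q) *
        ((∏ a ∈ u i, (tx none a + ∑ q ∈ J, tx (some q) a)) * ∏ e ∈ w j, (ty none e + ∑ q ∈ J, ty (some q) e))).det ≠ 0) :
    ∃ (tx ty : Option (Fin K) → Fin h → ℂ) (lam : Fin K → ℂ), (∀ b, tx none b = 0) ∧ (∀ b, ty none b = 0) ∧
      (Matrix.of fun i j : Fin r => ∑ J : Finset (Fin K), (∏ q ∈ J, lam q) *
        ((∏ a ∈ u i, (tx none a + ∑ q ∈ J, tx (some q) a)) * ∏ e ∈ w j, (ty none e + ∑ q ∈ J, ty (some q) e))).det ≠ 0 := by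
  obtain ⟨tx, ty, lam, hdet⟩ := H
  refine ⟨fun o b => o.elim 0 fun q => tx (some q) b, fun o b => o.elim 0 fun q => ty (some q) b, lam,
    fun _ => rfl, fun _ => rfl, ?_⟩
  have h1 := fullJoin_det_translate u w hul tx (fun o b => o.elim 0 fun q => tx (some q) b) ty lam (fun b => -tx none b)
    (fun b => by simp) (fun q b => rfl)
  have h2 := fullJoin_det_translate' u w hwl (fun o b => o.elim 0 fun q => tx (some q) b) ty
    (fun o b => o.elim 0 fun q => ty (some q) b) lam (fun b => -ty none b) (fun b => by simp) (fun q b => rfl)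
  intro h0
  apply hdet
  rw [← h1, ← h2]
  exact h0

end FullJoin

end

end Summit.ValiantsHypothesis.ValiantsHypothesis.Theorems.BarrierLever.HiddenStates
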